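import Literature.LinearAlgebra.Matrix.SubtypeZeroPadding
import Literature.MathematicalPhysics.QuantumLattice.TorusSectorGibbsScaleCovariance
import Literature.MathematicalPhysics.QuantumLattice.TorusSectorGibbsMixtureSymmetry
import Literature.MathematicalPhysics.QuantumLattice.TorusSectorGibbsEnergyWindow
import Literature.MathematicalPhysics.QuantumLattice.HubbardTorusMarkovPressureBound
import HarnessLib

/-!
# The canonical sector Gibbs state of the `t–t'` Hubbard torus as a DENSITY MATRIX of the Fock space:
# evenness, translation invariance, and the entropy identity `S = log Z_K + β E_β ≥ β (E_β − E₀)`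

Topic `MathematicalPhysics/QuantumLattice`; companion of `TorusSectorGibbsMixture.lean` (the canonical
Gibbs state of `H_L = hubbardTorusTT' L t t' U` on the sector `(N↑, N↓) = (halfRectN n L, halfRectN n L)`
presented as the eigen-MIXTURE `(p_{L,i}(β), ψ_{L,i})`), `TorusSectorGibbsEnergyWindow.lean` (the
compression `sectorHamiltonianTT'`, its partition function `Z_K`), `TorusSectorGibbsScaleCovariance.lean`
(mixture average = `gibbsState` of the compression) and `TorusSectorGibbsMixtureSymmetry.lean` (invariance
of the mixture under translations and `D₄`). The entropy rows of the thermal certificates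
(`FermionBoxSubadditivity.lean`, `TorusMarkovPressureBound.lean`: box / window subadditivity for EVEN,
TRANSLATION-INVARIANT density matrices of the torus) need the same state as ONE matrix:

* `sectorGibbsDensityTT' β t t' U n L` — the zero-padding (`padSubtype`) of the Gibbs density
  `Z_K⁻¹ e^{−βH_L|_K}` of the compression: the density matrix `ρ_{L,β} = P_K e^{−βH_L} / Z_K` of the
  canonical Gibbs state on the whole Fock space;
* `trace_sectorGibbsDensityTT'_mul` — `tr(ρ_{L,β} Y) = Σ_i p_{L,i} ⟨ψ_{L,i}, Y ψ_{L,i}⟩` for every `Y`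
  (so every statement of the mixture files is a statement about `ρ_{L,β}`); density-matrix properties;
* `parityAut_sectorGibbsDensityTT'` — `ρ_{L,β}` is EVEN (the sector has a fixed particle number);
* `relabel_translate_sectorGibbsDensityTT'` — `ρ_{L,β}` is TRANSLATION INVARIANT (uniqueness of the
  density matrix + the translation invariance of the mixture averages,
  `sum_sectorGibbsWeightTT'_mul_expect_fockTranslate_mulVec_eq`);
* `vonNeumannEntropy_sectorGibbsDensityTT'` — `S(ρ_{L,β}) = log Z_K + β E_β`
  (`vonNeumannEntropy_padSubtype` + `Matrix.IsHermitian.vonNeumannEntropy_gibbsDensity`), and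
  `mul_sub_groundEnergy_le_vonNeumannEntropy_sectorGibbsDensityTT'` — `β (E_β − E₀(L; rectN n L)) ≤ S(ρ_{L,β})`
  for `β ≥ 0` (`−log Z_K ≤ β E_min(K) ≤ β E₀`): the thermodynamic half of every «entropy row».

Everything is PROVED; one definition with body (`sectorGibbsDensityTT'`), no named fact.

References: Israel 1979 §I.3 eq. (26), Lemma II.3.1 [Israel1979]; Bratteli–Robinson II §5.3.1
[BratteliRobinsonII1997]; Araki–Moriya 2003 §4.1 Def. 4.5 (even / translation-invariant states)
[ArakiMoriya2003].
-/

noncomputable section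

namespace Literature.MathematicalPhysics.QuantumLattice

open Matrix Finset HubbardWave0 Literature.Probability.LatticeModels ThermodynamicLimit
open Literature.LinearAlgebra.Matrix (padSubtype trace_padSubtype_mul trace_padSubtype posSemidef_padSubtype
  isHermitian_padSubtype vonNeumannEntropy_padSubtype padSubtype_apply_of_pos padSubtype_apply_of_not_left
  padSubtype_apply_of_not_right)
open Literature.InformationTheory.Entropy (vonNeumannEntropy)
open _root_.Filter
open scoped _root_.Topology ComplexOrder BigOperators

section Density

variable (L : ℕ)

/-- **The canonical sector Gibbs density matrix** `ρ_{L,β} = P_K e^{−βH_L} / Z_K` of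
`H_L = hubbardTorusTT' L t t' U` on the sector `K = (N↑ = N↓ = halfRectN n L)` (`szConfig n L`), as a
matrix on the whole Fock space: the zero-padding of the Gibbs density of the compression
`sectorHamiltonianTT' t t' U n L`. [cite: Israel1979, §I.3 eq. (26)] -/
def sectorGibbsDensityTT' (β t t' U n : ℝ) :
    Matrix (Finset (Orb (FermionTorus 2 L))) (Finset (Orb (FermionTorus 2 L))) ℂ :=
  padSubtype (szConfig n L)
    ((partitionFn β (sectorHamiltonianTT' t t' U n L))⁻¹ • gibbsWeight β (sectorHamiltonianTT' t t' U n L))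

/-- **`ρ_{L,β}` represents the canonical Gibbs state**: `tr(ρ_{L,β} Y) = ⟨Y|_K⟩_β` in the Gibbs state of the
compression, for EVERY matrix `Y`. [cite: Israel1979, §I.3 eq. (26)] -/
theorem trace_sectorGibbsDensityTT'_mul_eq_gibbsState (β t t' U n : ℝ)
    (Y : Matrix (Finset (Orb (FermionTorus 2 L))) (Finset (Orb (FermionTorus 2 L))) ℂ) :
    (sectorGibbsDensityTT' L β t t' U n * Y).trace =
      gibbsState β (sectorHamiltonianTT' t t' U n L) (Y.submatrix Subtype.val Subtype.val) := by
  rw [sectorGibbsDensityTT', trace_padSubtype_mul, trace_gibbsDensity_mul]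

/-- **`ρ_{L,β}` is the eigen-mixture**: `tr(ρ_{L,β} Y) = Σ_i p_{L,i}(β) ⟨ψ_{L,i}, Y ψ_{L,i}⟩` for every `Y`.
[cite: Israel1979, §I.3 eq. (26)] -/
theorem trace_sectorGibbsDensityTT'_mul (β t t' U n : ℝ)
    (Y : Matrix (Finset (Orb (FermionTorus 2 L))) (Finset (Orb (FermionTorus 2 L))) ℂ) :
    (sectorGibbsDensityTT' L β t t' U n * Y).trace =
      ∑ i, (sectorGibbsWeightTT' β t t' U n L i : ℂ) * expect Y (sectorGibbsVectorTT' t t' U n L i) := by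
  rw [trace_sectorGibbsDensityTT'_mul_eq_gibbsState, sum_sectorGibbsWeightTT'_mul_expect_eq_gibbsState]

/-- Real form: `Re tr(ρ_{L,β} Y) = Σ_i p_{L,i} Re⟨ψ_{L,i}, Y ψ_{L,i}⟩`. [cite: Israel1979, §I.3 eq. (26)] -/
theorem re_trace_sectorGibbsDensityTT'_mul (β t t' U n : ℝ)
    (Y : Matrix (Finset (Orb (FermionTorus 2 L))) (Finset (Orb (FermionTorus 2 L))) ℂ) :
    (sectorGibbsDensityTT' L β t t' U n * Y).trace.re =
      ∑ i, sectorGibbsWeightTT' β t t' U n L i * (expect Y (sectorGibbsVectorTT' t t' U n L i)).re := by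
  rw [trace_sectorGibbsDensityTT'_mul, Complex.re_sum]
  refine Finset.sum_congr rfl fun i _ => ?_
  rw [Complex.re_ofReal_mul]

variable {n : ℝ}

/-- `ρ_{L,β}` is positive semidefinite. [cite: BratteliRobinsonII1997, §5.3.1] -/
theorem posSemidef_sectorGibbsDensityTT' (β t t' U n : ℝ) : (sectorGibbsDensityTT' L β t t' U n).PosSemidef :=
  posSemidef_padSubtype ((isHermitian_sectorHamiltonianTT' t t' U n L).posSemidef_gibbsDensity β)

/-- `tr ρ_{L,β} = 1` (`0 ≤ n ≤ 2`, so that the sector is nonempty). [cite: BratteliRobinsonII1997, §5.3.1] -/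
theorem trace_sectorGibbsDensityTT' (β t t' U : ℝ) (hn0 : 0 ≤ n) (hn2 : n ≤ 2) :
    (sectorGibbsDensityTT' L β t t' U n).trace = 1 := by
  haveI := nonempty_szConfig hn0 hn2 L
  rw [sectorGibbsDensityTT', trace_padSubtype]
  exact trace_gibbsDensity β _ (partitionFn_pos β (isHermitian_sectorHamiltonianTT' t t' U n L)).ne'

/-! ### Evenness -/

/-- **The canonical Gibbs density is EVEN**: `Θ ρ_{L,β} = ρ_{L,β}` (`Θ X = P X P`, `P = (−1)^N`, and `ρ_{L,β}`
lives on a sector of fixed particle number). [cite: ArakiMoriya2003, §4.1 Def. 4.5] -/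
theorem parityAut_sectorGibbsDensityTT' (β t t' U n : ℝ) :
    parityAut (sectorGibbsDensityTT' L β t t' U n) = sectorGibbsDensityTT' L β t t' U n := by
  refine parityAut_eq_self_of_preservesSectors fun s s' h => ?_
  by_cases hs : szConfig n L s
  · by_cases hs' : szConfig n L s'
    · exact ⟨hs.1.trans hs'.1.symm, hs.2.trans hs'.2.symm⟩
    · exact absurd (padSubtype_apply_of_not_right _ _ hs') h
  · exact absurd (padSubtype_apply_of_not_left _ hs _) h

/-! ### Translation invariance -/

variable [NeZero L]

/-- **The canonical Gibbs density is TRANSLATION INVARIANT**: `Γ(τ_w) ρ_{L,β} = ρ_{L,β}` for every torus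
translation `w` (uniqueness of the density matrix: both sides have the same trace against every `Y`, by the
translation invariance of the mixture averages). [cite: ArakiMoriya2003, §4.1 Def. 4.5] -/
theorem relabel_translate_sectorGibbsDensityTT' (β t t' U n : ℝ) (w : TorusSite 2 L) :
    relabel (Orb.translate w) (sectorGibbsDensityTT' L β t t' U n) = sectorGibbsDensityTT' L β t t' U n := by
  refine Matrix.ext_iff_trace_mul_right.2 fun Y => ?_
  have hU : (fockTranslate w).valᴴ = (fockTranslate (-w)).val := fockTranslate_val_conjTranspose_eq_neg L w
  have hconj : (fockTranslate w).valᴴ * Y * (fockTranslate w).val = relabel (Orb.translate (-w)) Y := by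
    rw [relabel_eq_fockRelabel_conj]
    change _ = (fockTranslate (-w)).val * Y * (fockTranslate (-w)).valᴴ
    rw [← hU, Matrix.conjTranspose_conjTranspose]
  have hsymm : Orb.translate (-w) = (Orb.translate w).symm := by
    rw [Orb.translate_neg, Equiv.Perm.inv_def]
  calc (relabel (Orb.translate w) (sectorGibbsDensityTT' L β t t' U n) * Y).trace
      = ((fockTranslate w).val * (sectorGibbsDensityTT' L β t t' U n * (fockTranslate w).valᴴ * Y)).trace := by
        rw [relabel_eq_fockRelabel_conj]
        simp only [Matrix.mul_assoc]
    _ = (sectorGibbsDensityTT' L β t t' U n * ((fockTranslate w).valᴴ * Y * (fockTranslate w).val)).trace := by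
        rw [Matrix.trace_mul_comm]
        simp only [Matrix.mul_assoc]
    _ = (sectorGibbsDensityTT' L β t t' U n * relabel (Orb.translate (-w)) Y).trace := by rw [hconj]
    _ = ∑ i, (sectorGibbsWeightTT' β t t' U n L i : ℂ) *
          expect (relabel (Orb.translate (-w)) Y) (sectorGibbsVectorTT' t t' U n L i) :=
        trace_sectorGibbsDensityTT'_mul L β t t' U n _
    _ = ∑ i, (sectorGibbsWeightTT' β t t' U n L i : ℂ) *
          expect Y ((fockTranslate w).val *ᵥ sectorGibbsVectorTT' t t' U n L i) := by
        refine Finset.sum_congr rfl fun i _ => ?_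
        rw [hsymm, ← expect_fockRelabel_mulVec]
    _ = ∑ i, (sectorGibbsWeightTT' β t t' U n L i : ℂ) * expect Y (sectorGibbsVectorTT' t t' U n L i) :=
        sum_sectorGibbsWeightTT'_mul_expect_fockTranslate_mulVec_eq L t t' U n β w Y
    _ = (sectorGibbsDensityTT' L β t t' U n * Y).trace := (trace_sectorGibbsDensityTT'_mul L β t t' U n Y).symm

/-! ### The entropy identity and the thermodynamic inequality `β (E_β − E₀) ≤ S(ρ_{L,β})` -/

omit [NeZero L] in
/-- **`S(ρ_{L,β}) = log Z_K + β E_β`** (entropy of the canonical Gibbs state = log of the canonical partition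
function + `β ×` the canonical energy), `E_β = Re⟨H_L|_K⟩_β`. [cite: Israel1979, Lemma II.3.1] -/
theorem vonNeumannEntropy_sectorGibbsDensityTT' (β t t' U : ℝ) (hn0 : 0 ≤ n) (hn2 : n ≤ 2) :
    vonNeumannEntropy (sectorGibbsDensityTT' L β t t' U n) =
      Real.log (partitionFn β (sectorHamiltonianTT' t t' U n L)).re +
        β * (gibbsState β (sectorHamiltonianTT' t t' U n L) (sectorHamiltonianTT' t t' U n L)).re := by
  haveI := nonempty_szConfig hn0 hn2 L
  rw [sectorGibbsDensityTT',
    vonNeumannEntropy_padSubtype ((isHermitian_sectorHamiltonianTT' t t' U n L).posSemidef_gibbsDensity β).1,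
    (isHermitian_sectorHamiltonianTT' t t' U n L).vonNeumannEntropy_gibbsDensity β, gibbsEntropy_def]

omit [NeZero L] in
/-- The canonical energy through the density matrix: `Re tr(ρ_{L,β} H_L) = Re⟨H_L|_K⟩_β`.
[cite: Israel1979, Lemma II.3.1] -/
theorem re_trace_sectorGibbsDensityTT'_mul_hubbardTorusTT' (β t t' U n : ℝ) :
    (sectorGibbsDensityTT' L β t t' U n * hubbardTorusTT' L t t' U).trace.re =
      (gibbsState β (sectorHamiltonianTT' t t' U n L) (sectorHamiltonianTT' t t' U n L)).re := by
  rw [trace_sectorGibbsDensityTT'_mul_eq_gibbsState]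
  rfl

/-- **`β (E_β − E₀) ≤ S(ρ_{L,β})`** for `β ≥ 0`: `S = log Z_K + β E_β` and `−log Z_K ≤ β E_min(K)`, with the
sector ground energy `E_min(K)` at most (in fact equal to) the `rectN n L`-particle ground energy `E₀(L)`
(`groundEnergy_submatrix_le_minEnergyOn`, `groundEnergy_hubbardTorusTT'_eq_minEnergyOn_szSector`). This is
`F_L = E_β − T S ≤ E₀(L)`, the thermodynamic input of every entropy row. [cite: Israel1979, Lemma II.3.1] -/
theorem mul_sub_groundEnergy_le_vonNeumannEntropy_sectorGibbsDensityTT' (t t' U : ℝ) (hn0 : 0 ≤ n)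
    (hn2 : n ≤ 2) {β : ℝ} (hβ : 0 ≤ β) :
    β * ((sectorGibbsDensityTT' L β t t' U n * hubbardTorusTT' L t t' U).trace.re -
        groundEnergy (hubbardTorusTT' L t t' U) (rectN n L)) ≤
      vonNeumannEntropy (sectorGibbsDensityTT' L β t t' U n) := by
  haveI := nonempty_szConfig hn0 hn2 L
  set H := hubbardTorusTT' L t t' U with hH
  have hA : H.IsHermitian := hubbardTorusTT'_isHermitian L t t' U
  have hHs := isHermitian_sectorHamiltonianTT' t t' U n L
  rw [vonNeumannEntropy_sectorGibbsDensityTT' L β t t' U hn0 hn2, re_trace_sectorGibbsDensityTT'_mul_hubbardTorusTT']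
  -- `−log Z_K ≤ β E_min(K)`
  have h1 := hHs.neg_log_partitionFn_le_mul_groundEnergy β
  -- `E_min(K) ≤ E₀(L; rectN n L)`
  have hinv : ∀ s s', ¬ szConfig n L s → szConfig n L s' → H s s' = 0 :=
    fun s s' hs hs' => hubbardTorusTT'_apply_eq_zero_of_szConfig L t t' U n s s' hs hs'
  have hp : ∃ s, szConfig n L s := exists_szConfig hn0 hn2 L
  have hK : ∀ v : Fock (Orb (FermionTorus 2 L)), v ∈ szSector (rectN n L) (0 : ℝ) ↔
      ∀ s, ¬ szConfig n L s → v s = 0 := mem_szSector_rectN_iff n L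
  have hcardN : halfRectN n L ≤ Fintype.card (FermionTorus 2 L) := by
    have h := ThermodynamicLimit.rectN_le_two_mul hn0 hn2 L
    have hr : rectN n L = 2 * halfRectN n L := rfl
    rw [hr] at h
    have hcard : Fintype.card (FermionTorus 2 L) = L * L := by simp [FermionTorus, sq]
    rw [hcard]
    exact Nat.le_of_mul_le_mul_left h two_pos
  have h2 : (sectorHamiltonianTT' t t' U n L).groundEnergy ≤ groundEnergy H (rectN n L) := by
    have h := groundEnergy_submatrix_le_minEnergyOn (szConfig n L) hA hinv hp (szSector (rectN n L) 0) hK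
    have hr : rectN n L = 2 * halfRectN n L := rfl
    rwa [hr, ← groundEnergy_hubbardTorusTT'_eq_minEnergyOn_szSector L t t' U hcardN,
      ← hr] at h
  have h3 : β * (sectorHamiltonianTT' t t' U n L).groundEnergy ≤ β * groundEnergy H (rectN n L) :=
    mul_le_mul_of_nonneg_left h2 hβ
  linarith

end Density

end Literature.MathematicalPhysics.QuantumLattice

end
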